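import Summits.Schanuel.Schanuel.Theorems.DiophantineDichotomyKhovanskiiApproxTypeEvRareFieldDefs
import Summits.Schanuel.Schanuel.Theorems.DiophantineDichotomyKhovanskiiApproxTypeSlotDichotomyTwo
import HarnessLib

/-!
# Stub `stub_dhOfPrimitiveY` of line `rare-field-species` — crux `KhovanskiiApproxTypeEv`
# (stmt-Schanuel-14972): THRESHOLD BOOKKEEPING `DhOfPrimitiveY`

Route `DiophantineDichotomy` (sub-problem `Schanuel/Schanuel`), line lead
`prover-line-stmt-Schanuel-14972-a4-0`, support skeleton
`Cruxes/KhovanskiiApproxTypeEv/Lines/rare_field_species.lean`, vocabulary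
`Theorems/DiophantineDichotomyKhovanskiiApproxTypeEvRareFieldDefs.lean` (p136201).

`DhOfPrimitiveY`: a primitive approximation measure `PrimitiveApproxMeasureX n (e^s) p κ C` in the Ably
penalty class with exponent `p ≥ 1` at `ω = e^s ∈ ℂⁿ` (the `y`-half of `θ = (s, e^s)`) gives the
`(d,h)`-currency eventual type `ApproxTypeDhEvYAt n s p (2C+1)` at `θ`.  This is the load-bearing stub
of the line: with it, `EvLWDh` (the Lindemann–Weierstrass layer in `(d,h)` currency at EVERY rank
`n ≥ 1`, exponent `1 + 1/n`) is a theorem (`evLWDh_of`, from the landed `stub_lwPenaltyMeasure` — Ably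
1994, PROVED p121092 — and `stub_penaltyTransfer`, p85905).

Proof (the docstring derivation of `DhOfPrimitiveY`, verbatim): restrict the challenger `γ` to its
`y`-part `γ ∘ inr` (`‖γ ∘ inr − e^s‖ ≤ ‖γ − θ‖` for the sup norm; `finrank ℚ(γ ∘ inr) ≤ finrank ℚ(γ)
≤ d` by `IntermediateField.finiteDimensional_adjoin` + `finrank_le_of_le_right` + `adjoin.mono`,
integrality of the coordinates from the clause via `natDegree_pos_of_aeval_eq_zero` — the CASE 1 block
of `stub_penaltySlotDichotomy_two`), apply the measure with `d' = m`, and absorb the penalty above the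
threshold `H₀(d) = ⌈exp(max d (exp(κ d log(d+2))))⌉₊`: there `d ≤ log H` gives
`C dᵖ(log H + d)/m ≤ 2C dᵖ log H/m`, and `exp(κ d log(d+2)) ≤ log H ≤ dᵖ log H/m` because
`m ≤ d ≤ dᵖ` (`p ≥ 1`, `d ≥ m ≥ 1`) — `threshold_bookkeeping`.
-/

noncomputable section

-- `Summit.Schanuel.Schanuel.…` is the mandated summit/sub-problem namespace (single-conjunct summit), hence:
set_option linter.dupNamespace false

namespace Summit.Schanuel.Schanuel.Cruxes.KhovanskiiApproxTypeEv.RareFieldSpecies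

open Summit.Schanuel.Schanuel.Cruxes.KhovanskiiApproxType.LwSmallHeight
  (natDegree_pos_of_aeval_eq_zero)
open Summit.Schanuel.Schanuel.Cruxes.KhovanskiiApproxType.HeightWindowCompactness
  (PrimitiveApproxMeasureX)

/-- THRESHOLD ARITHMETIC of `DhOfPrimitiveY`: for `C > 0`, `p ≥ 1`, `1 ≤ m ≤ d`, and a height
logarithm `L` above both thresholds (`d ≤ L`, `exp(κ d log(d+2)) ≤ L`),
`C dᵖ (L + d)/m + exp(κ d log(d+2)) ≤ (2C+1) dᵖ L / m`. [folklore] -/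
theorem threshold_bookkeeping {C p κ d m L : ℝ} (hC : 0 < C) (hp : 1 ≤ p) (hm1 : 1 ≤ m)
    (hmd : m ≤ d) (hdL : d ≤ L) (hEL : Real.exp (κ * d * Real.log (d + 2)) ≤ L) :
    C * d ^ p * (L + d) / m + Real.exp (κ * d * Real.log (d + 2)) ≤ (2 * C + 1) * d ^ p * L / m := by
  have hd1 : 1 ≤ d := hm1.trans hmd
  have hm0 : 0 < m := one_pos.trans_le hm1
  have hL0 : 0 ≤ L := (zero_le_one.trans hd1).trans hdL
  have hdp0 : 0 ≤ d ^ p := Real.rpow_nonneg (zero_le_one.trans hd1) p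
  have hdp : d ≤ d ^ p := by
    calc d = d ^ (1 : ℝ) := (Real.rpow_one d).symm
      _ ≤ d ^ p := Real.rpow_le_rpow_of_exponent_le hd1 hp
  have hmdp : m ≤ d ^ p := hmd.trans hdp
  have h1 : C * d ^ p * (L + d) / m ≤ 2 * C * d ^ p * L / m := by
    refine div_le_div_of_nonneg_right ?_ hm0.le
    have : C * d ^ p * (L + d) ≤ C * d ^ p * (L + L) :=
      mul_le_mul_of_nonneg_left (by linarith) (mul_nonneg hC.le hdp0)
    linarith
  have h2 : Real.exp (κ * d * Real.log (d + 2)) ≤ d ^ p * L / m := by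
    refine hEL.trans ?_
    rw [le_div_iff₀ hm0]
    calc L * m ≤ L * d ^ p := mul_le_mul_of_nonneg_left hmdp hL0
      _ = d ^ p * L := mul_comm _ _
  calc C * d ^ p * (L + d) / m + Real.exp (κ * d * Real.log (d + 2))
      ≤ 2 * C * d ^ p * L / m + d ^ p * L / m := add_le_add h1 h2
    _ = (2 * C + 1) * d ^ p * L / m := by ring

/-- **Registered stub `stub_dhOfPrimitiveY : DhOfPrimitiveY`** (line `rare-field-species`, crux
stmt-Schanuel-14972): a primitive approximation measure with exponent `p ≥ 1` at the `y`-half `e^s`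
gives the `(d,h)`-currency eventual type `(p, 2C+1)` at `θ = (s, e^s)`, thresholds
`H₀(d) = ⌈exp(max d (exp(κ d log(d+2))))⌉₊`. [folklore] -/
theorem stub_dhOfPrimitiveY : DhOfPrimitiveY := by
  intro n s p κ C hp hPM
  have hC : 0 < C := hPM.1
  refine ⟨2 * C + 1, by linarith, fun d => ?_⟩
  refine ⟨⌈Real.exp (max (d : ℝ) (Real.exp (κ * d * Real.log ((d : ℝ) + 2))))⌉₊, ?_⟩
  intro H m γ hH₀ hm1 hmd hfr hpoly hdeg
  set θ : Fin n ⊕ Fin n → ℂ := Sum.elim s (Complex.exp ∘ s) with hθ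
  have hHexp : Real.exp (max (d : ℝ) (Real.exp (κ * d * Real.log ((d : ℝ) + 2)))) ≤ (H : ℝ) :=
    (Nat.le_ceil _).trans (by exact_mod_cast hH₀)
  have hHpos : (0 : ℝ) < H := (Real.exp_pos _).trans_le hHexp
  have hlogH : max (d : ℝ) (Real.exp (κ * d * Real.log ((d : ℝ) + 2))) ≤ Real.log H :=
    (Real.le_log_iff_exp_le hHpos).2 hHexp
  have hdL : (d : ℝ) ≤ Real.log H := (le_max_left _ _).trans hlogH
  have hEL : Real.exp (κ * d * Real.log ((d : ℝ) + 2)) ≤ Real.log H :=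
    (le_max_right _ _).trans hlogH
  have hint : ∀ j, IsIntegral ℚ (γ j) := fun j => by
    obtain ⟨P, hP0, -, -, hPγ⟩ := hpoly j
    exact (natDegree_pos_of_aeval_eq_zero hP0 hPγ).2
  have hfr' : Module.finrank ℚ ↥(IntermediateField.adjoin ℚ (Set.range (γ ∘ Sum.inr))) ≤ d := by
    refine le_trans ?_ hfr
    haveI : FiniteDimensional ℚ ↥(IntermediateField.adjoin ℚ (Set.range γ)) :=
      IntermediateField.finiteDimensional_adjoin (fun x hx => by
        obtain ⟨j, rfl⟩ := hx
        exact hint j)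
    exact IntermediateField.finrank_le_of_le_right
      (IntermediateField.adjoin.mono ℚ _ _ (Set.range_comp_subset_range Sum.inr γ))
  have hkey := hPM.2 d m H (γ ∘ Sum.inr) hm1 hfr' (fun j => hdeg j) (fun j => hpoly (Sum.inr j))
  have hsup : ‖γ ∘ Sum.inr - Complex.exp ∘ s‖ ≤ ‖γ - θ‖ :=
    (pi_norm_le_iff_of_nonneg (norm_nonneg _)).2 fun j => by
      simpa [hθ] using norm_le_pi_norm (γ - θ) (Sum.inr j)
  have hm1r : (1 : ℝ) ≤ m := by exact_mod_cast hm1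
  have hmdr : (m : ℝ) ≤ d := by exact_mod_cast hmd
  have hbk := threshold_bookkeeping hC hp hm1r hmdr hdL hEL (κ := κ)
  exact le_trans (Real.exp_le_exp.2 (by linarith)) (hkey.trans hsup)

end Summit.Schanuel.Schanuel.Cruxes.KhovanskiiApproxTypeEv.RareFieldSpecies

end
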